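import Mathlib.Data.Real.Basic
import Mathlib.Data.Fintype.Pi
import Mathlib.Data.Finset.Card

/-!
# Vocabulary of Ambainis's relational adversary bound (crux `WhiteBoxWalk.WbwVerifiableLineNoSpeedup`,
stmt-QuantumAdvantage-2239, line `cycle-surgery-adversary`)

For a finite relation `R` on `N`-bit strings: the partner counts `l_{x,i}` (`leftCount`),
`l_{y,i}` (`rightCount`), the degrees (`leftDeg`, `rightDeg`), Ambainis's product hypothesis
`ProductBound R L` (`l_{x,i} · l_{y,i} ≤ L` on every related pair and differing bit) and the
well-formedness predicate `RelWellFormed D f X Y R` (`R ⊆ X × Y`, inside the promise `D`,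
`f`-separated) [A. Ambainis, *Quantum lower bounds by quantum arguments*, JCSS 64 (2002), §5,
Thm 6]. The bound itself (`stub_relationalAdversary`) lands in a sibling file. Definitions only. -/

set_option linter.dupNamespace false

namespace Summit.QuantumAdvantage.QuantumAdvantage.Theorems.WbwVerifiableLineNoSpeedup.CycleSurgery

section Adversary

variable {n : ℕ}

/-- `l_{x,i}`: the number of pairs `(x, y') ∈ R` (partners of `x` on the left) with `x_i ≠ y'_i`. -/
def leftCount (R : Finset ((Fin n → Bool) × (Fin n → Bool))) (x : Fin n → Bool) (i : Fin n) : ℕ :=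
  (R.filter fun q => q.1 = x ∧ q.1 i ≠ q.2 i).card

/-- `l_{y,i}`: the number of pairs `(x', y) ∈ R` (partners of `y` on the right) with `x'_i ≠ y_i`. -/
def rightCount (R : Finset ((Fin n → Bool) × (Fin n → Bool))) (y : Fin n → Bool) (i : Fin n) : ℕ :=
  (R.filter fun q => q.2 = y ∧ q.1 i ≠ q.2 i).card

/-- Left degree of `x` in `R`. -/
def leftDeg (R : Finset ((Fin n → Bool) × (Fin n → Bool))) (x : Fin n → Bool) : ℕ :=
  (R.filter fun q => q.1 = x).card

/-- Right degree of `y` in `R`. -/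
def rightDeg (R : Finset ((Fin n → Bool) × (Fin n → Bool))) (y : Fin n → Bool) : ℕ :=
  (R.filter fun q => q.2 = y).card

/-- Ambainis's product hypothesis: for every related pair and every bit where the pair differs,
`l_{x,i} · l_{y,i} ≤ L`. -/
def ProductBound (R : Finset ((Fin n → Bool) × (Fin n → Bool))) (L : ℝ) : Prop :=
  ∀ p ∈ R, ∀ i : Fin n, p.1 i ≠ p.2 i → (leftCount R p.1 i : ℝ) * rightCount R p.2 i ≤ L

/-- The relation lives on `X × Y`, inside the promise, and separates `f`-values. -/
def RelWellFormed (D : Set (Fin n → Bool)) (f : (Fin n → Bool) → Bool) (X Y : Finset (Fin n → Bool))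
    (R : Finset ((Fin n → Bool) × (Fin n → Bool))) : Prop :=
  ∀ p ∈ R, p.1 ∈ X ∧ p.2 ∈ Y ∧ p.1 ∈ D ∧ p.2 ∈ D ∧ f p.1 ≠ f p.2

/-- A degree is at most the size of the relation (the registered sub-goal this definitions file
discharges). -/
theorem leftDeg_le_card : ∀ {n : ℕ} (R : Finset ((Fin n → Bool) × (Fin n → Bool))) (x : Fin n → Bool),
    leftDeg R x ≤ R.card := fun R _ => Finset.card_filter_le R _

end Adversary


end Summit.QuantumAdvantage.QuantumAdvantage.Theorems.WbwVerifiableLineNoSpeedup.CycleSurgery
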